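import Mathlib
import Literature.Analysis.FunctionSpaces.TorusTrigPoly
import Literature.Analysis.FunctionSpaces.TorusFourierModes
import Literature.Analysis.FunctionSpaces.TorusDirichletKernel
import Literature.Analysis.FunctionSpaces.TorusCalculusProofs
import Summits.AnomalousDissipation.AnomalousDissipation.Theorems.TaylorCertificatesPacketLemmaSpectrum
import Summits.AnomalousDissipation.AnomalousDissipation.Theorems.TaylorCertificatesPacketLemmaStrain
import Summits.AnomalousDissipation.AnomalousDissipation.Theorems.TaylorCertificatesPacketLemmaPacket
import Summits.AnomalousDissipation.AnomalousDissipation.Theorems.TaylorCertificatesPacketLemmaPointwise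
import HarnessLib

/-!
# Route TaylorCertificates — `PacketLemma`, helper 8: the inertial form and the energy of the packet

The two estimates behind
`Summit.AnomalousDissipation.AnomalousDissipation.Theses.TaylorCertificates.PacketLemma`
(item stmt-AnomalousDissipation-14032). Let `W` be a smooth field on `T³`, band-limited to the
ball `|k| ≤ D`, whose strain form is bounded by `s` on unit vectors; let `ψ` be a real envelope
with `ψ = ∑_{k∈Ω_M} α_k e_k`, `Z = ∫ ψ²`, concentrated at `x₀` (`∫ ψ² |1-e_1(xᵢ-x₀ᵢ)|²/4 ≤ ε² Z`);
let `p ∈ ℤ³` be a carrier with `|2pᵢ| > 2M + D` for some `i`, `a` a unit vector, `P = p × a`, and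
`w₀ = realTrigPoly (Ω_M + p) c`, `c_m = 2π α_{m-p} (m × a)` the packet of
`TaylorCertificatesPacketLemmaPacket`, `w₀ = (2π Re(e_p ψ)) P + r` with `‖r‖ ≤ ‖U‖`,
`∫ ‖U‖² ≤ 12π² M² Z`. Then (`packet_estimates`), with `n = M + 1` and
`G(x) = ⟪P, (P·∇)W(x)⟫`:

* `∫ ⟪w₀, (w₀·∇)W⟫ ≤ 2π² G(x₀) Z + s Z (12π² D ε ‖P‖² + 14π² n ‖P‖ + 12π² n²)`;
* `2π² ‖P‖² Z - 14π² n ‖P‖ Z ≤ ∫ ‖w₀‖² ≤ 2π² ‖P‖² Z + 14π² n ‖P‖ Z + 12π² n² Z`.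

The main term is `4π² Re(e_p)² ψ² G = 2π² ψ² G + 2π² ψ² G Re(e_{2p})`; the oscillatory half has
spectrum in `Ω_{2M+D} + 2p ∌ 0` and integrates to zero (`spec_integral_eq_zero`), and
`∫ ψ² G ≤ G(x₀) Z + 6 D s‖P‖² ε Z` is the kernel estimate `integral_mul_le_of_windows` fed by the
Bernstein–Szegő modulus of continuity `abs_sub_le_sum_of_re_trigPoly`. Cross terms are handled
by the polarisation bound `abs_inner_add_inner_le` and pointwise AM–GM
(`inner_packet_pointwise_le`, `norm_packet_pointwise_bounds` of `TaylorCertificatesPacketLemmaPointwise`).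

No definitions, no named facts.
-/

noncomputable section

open MeasureTheory UnitAddTorus Complex Real
open scoped ComplexConjugate Pointwise

namespace Summit.AnomalousDissipation.AnomalousDissipation.Theorems

-- the mandated namespace `Summit.<Summit>.<Problem>.Theorems` repeats `AnomalousDissipation` (single-problem summit)
set_option linter.dupNamespace false

open Literature.Analysis.FunctionSpaces Literature.Analysis.FunctionSpaces.Torus

/-! ### The two estimates -/

/-- **Inertial form and energy of the packet** (see the module docstring for the setting and the
statement). [folklore] -/
theorem packet_estimates
    -- the multiplier `W` and its strain bound
    (W : UnitAddTorus (Fin 3) → EuclideanSpace ℝ (Fin 3)) {D : ℕ}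
    (Ŵ : (Fin 3 → ℤ) → EuclideanSpace ℂ (Fin 3)) (hWeq : W = realTrigPoly (freqBall D) Ŵ)
    {s : ℝ} (hs0 : 0 ≤ s)
    (hs : ∀ (x : UnitAddTorus (Fin 3)) (η : EuclideanSpace ℝ (Fin 3)), ‖η‖ = 1 →
      |inner ℝ η (convect (fun _ => η) W x)| ≤ s)
    -- the envelope
    {M : ℕ} (α : (Fin 3 → ℤ) → ℂ) (ψ : UnitAddTorus (Fin 3) → ℝ)
    (hψ : ∀ x, ((ψ x : ℝ) : ℂ) = trigPoly (freqCube M) α x)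
    (x₀ : UnitAddTorus (Fin 3)) {ε : ℝ} (hε : 0 < ε)
    (hwin : ∀ i, ∫ x, ψ x ^ 2 * (‖(1 : ℂ) - fourier 1 (x i - x₀ i)‖ ^ 2 / 4) ≤ ε ^ 2 * ∫ x, ψ x ^ 2)
    -- the carrier, the direction, the packet
    (p : Fin 3 → ℤ) (hp : ∃ i, ((2 * M + D : ℕ) : ℤ) < |2 * p i|)
    (a : EuclideanSpace ℝ (Fin 3)) (ha : ‖a‖ = 1)
    (P : EuclideanSpace ℝ (Fin 3))
    (hP : P = WithLp.toLp 2 (crossProduct (WithLp.ofLp (latticeVec p)) (WithLp.ofLp a)))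
    (c u : (Fin 3 → ℤ) → EuclideanSpace ℂ (Fin 3))
    (hc : ∀ m, c m = ((2 * π : ℂ) * α (m - p)) • EuclideanSpace.complexify
      (WithLp.toLp 2 (crossProduct (WithLp.ofLp (latticeVec m)) (WithLp.ofLp a)) : EuclideanSpace ℝ (Fin 3)))
    (hu : ∀ k, u k = ((2 * π : ℂ) * α k) • EuclideanSpace.complexify
      (WithLp.toLp 2 (crossProduct (WithLp.ofLp (latticeVec k)) (WithLp.ofLp a)) : EuclideanSpace ℝ (Fin 3)))
    (w₀ : UnitAddTorus (Fin 3) → EuclideanSpace ℝ (Fin 3))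
    (hw₀ : w₀ = realTrigPoly ((freqCube M).image (· + p)) c)
    (G : UnitAddTorus (Fin 3) → ℝ) (hG : ∀ x, G x = inner ℝ P (convect (fun _ => P) W x)) :
    (∫ x, inner ℝ (w₀ x) (convect w₀ W x) ≤
        2 * π ^ 2 * G x₀ * (∫ x, ψ x ^ 2) +
          s * (12 * π ^ 2 * D * ε * ‖P‖ ^ 2 + 14 * π ^ 2 * (M + 1) * ‖P‖ + 12 * π ^ 2 * (M + 1) ^ 2) *
            ∫ x, ψ x ^ 2) ∧
      (2 * π ^ 2 * ‖P‖ ^ 2 * (∫ x, ψ x ^ 2) - 14 * π ^ 2 * (M + 1) * ‖P‖ * (∫ x, ψ x ^ 2) ≤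
        ∫ x, ‖w₀ x‖ ^ 2) ∧
      (∫ x, ‖w₀ x‖ ^ 2 ≤ 2 * π ^ 2 * ‖P‖ ^ 2 * (∫ x, ψ x ^ 2) +
        14 * π ^ 2 * (M + 1) * ‖P‖ * (∫ x, ψ x ^ 2) + 12 * π ^ 2 * (M + 1) ^ 2 * ∫ x, ψ x ^ 2) := by
  classical
  -- ### unpack the setting
  have hWs : IsSmooth W := by rw [hWeq]; exact isSmooth_realTrigPoly _ _
  have hA : ∀ (x : UnitAddTorus (Fin 3)) (η : EuclideanSpace ℝ (Fin 3)), ‖η‖ = 1 →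
      |inner ℝ η (Torus.fderiv W x η)| ≤ s := fun x η hη => hs x η hη
  have hn0 : (0 : ℝ) < M + 1 := by positivity
  have hMn : (M : ℝ) ≤ M + 1 := by linarith
  -- the envelope
  have hψre : ∀ x, ψ x = (trigPoly (freqCube M) α x).re := fun x => by rw [← hψ x, Complex.ofReal_re]
  have hψfun : (fun x => ((ψ x : ℝ) : ℂ)) = trigPoly (freqCube M) α := funext hψ
  have hψc : Continuous ψ := by
    rw [show ψ = fun x => (trigPoly (freqCube M) α x).re from funext hψre]
    exact Complex.continuous_re.comp (continuous_trigPoly _ _)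
  have hnormψ : ∀ x, ‖trigPoly (freqCube M) α x‖ = |ψ x| := fun x => by
    rw [← hψ x, Complex.norm_real, Real.norm_eq_abs]
  obtain ⟨Z, hZ⟩ : ∃ Z : ℝ, Z = ∫ x, ψ x ^ 2 := ⟨_, rfl⟩
  rw [← hZ] at hwin ⊢
  have hZpar : ∫ x, ‖trigPoly (freqCube M) α x‖ ^ 2 = Z := by
    simp_rw [hnormψ, sq_abs, hZ]
  have hZ0 : 0 ≤ Z := by rw [hZ]; exact integral_nonneg fun x => sq_nonneg _
  -- the remainder field `U`
  obtain ⟨U, hUdef⟩ : ∃ U : UnitAddTorus (Fin 3) → EuclideanSpace ℂ (Fin 3), U = trigPoly (freqCube M) u :=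
    ⟨_, rfl⟩
  have hUc : Continuous U := by rw [hUdef]; exact continuous_trigPoly _ _
  have hUn : ∫ x, ‖U x‖ ^ 2 ≤ 12 * π ^ 2 * (M + 1) ^ 2 * Z := by
    have h := integral_norm_sq_crossPoly_le M a α u hu
    rw [ha, one_pow, mul_one, hZpar, ← hUdef] at h
    refine h.trans ?_
    have : (M : ℝ) ^ 2 ≤ (M + 1) ^ 2 := pow_le_pow_left₀ (Nat.cast_nonneg M) hMn 2
    have h12 : 0 ≤ 12 * π ^ 2 * Z := by positivity
    nlinarith [mul_le_mul_of_nonneg_left this h12]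
  -- the decomposition `w₀ = m • P + r`
  obtain ⟨m, hmdef⟩ : ∃ m : UnitAddTorus (Fin 3) → ℝ,
      ∀ x, m x = 2 * π * (mFourier p x * trigPoly (freqCube M) α x).re := ⟨_, fun x => rfl⟩
  obtain ⟨r, hrdef⟩ : ∃ r : UnitAddTorus (Fin 3) → EuclideanSpace ℝ (Fin 3),
      ∀ x, r x = EuclideanSpace.realPart (mFourier p x • U x) := ⟨_, fun x => rfl⟩
  have hdec : ∀ x, w₀ x = m x • P + r x := fun x => by
    rw [hw₀, hmdef, hrdef, hP, hUdef]
    exact realTrigPoly_packet_eq M p a α c u hc hu x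
  have hmψ : ∀ x, m x = 2 * π * ((mFourier p x).re * ψ x) := fun x => by
    rw [hmdef, ← hψ x, Complex.re_mul_ofReal]
  have hm_abs : ∀ x, |m x| ≤ 2 * π * |ψ x| := fun x => by
    rw [hmdef, abs_mul, abs_of_pos Real.two_pi_pos]
    refine mul_le_mul_of_nonneg_left ?_ Real.two_pi_pos.le
    refine (Complex.abs_re_le_norm _).trans ?_
    rw [norm_mul, norm_mFourier_apply, one_mul, hnormψ]
  have hm_sq : ∀ x, m x ^ 2 = 2 * π ^ 2 * ψ x ^ 2 + 2 * π ^ 2 * ψ x ^ 2 * ((mFourier p x) ^ 2).re := fun x => by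
    rw [hmψ]
    have h := re_sq_eq_of_norm_eq_one (norm_mFourier_apply p x)
    have h' : ((mFourier p x).re * ψ x) ^ 2 = ψ x ^ 2 * ((1 + ((mFourier p x) ^ 2).re) / 2) := by
      rw [mul_pow, h]; ring
    rw [mul_pow, h']
    ring
  have hr_le : ∀ x, ‖r x‖ ≤ ‖U x‖ := fun x => by
    rw [hrdef]; exact norm_realPart_smul_le (norm_mFourier_apply p x).le _
  -- the strain form `G` as a scalar trigonometric polynomial
  obtain ⟨Γ, hΓ⟩ : ∃ Γ : (Fin 3 → ℤ) → ℂ, Γ = fun k => inner ℂ (EuclideanSpace.complexify P)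
      ((2 * π * Complex.I * ∑ j, (P j : ℂ) * (k j : ℂ)) • Ŵ k) := ⟨_, rfl⟩
  have hGre : ∀ x, G x = (trigPoly (freqBall D) Γ x).re := fun x => by
    rw [hG x, hWeq, inner_convect_const_realTrigPoly, hΓ]
  have hGc : Continuous G := by
    rw [show G = fun x => (trigPoly (freqBall D) Γ x).re from funext hGre]
    exact Complex.continuous_re.comp (continuous_trigPoly _ _)
  have hGB : ∀ x, |(trigPoly (freqBall D) Γ x).re| ≤ s * ‖P‖ ^ 2 := fun x => by
    rw [← hGre, hG]
    exact inner_self_le_of_unit_bound (Torus.fderiv W x) (hA x) P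
  -- ### the kernel estimate `∫ ψ² G ≤ G x₀ Z + 6 D ε s ‖P‖² Z`
  have hker : ∫ x, ψ x ^ 2 * G x ≤ G x₀ * Z + 2 * 3 * (D * (s * ‖P‖ ^ 2)) * ε * Z := by
    have hL : ∀ x, |G x - G x₀| ≤ D * (s * ‖P‖ ^ 2) * ∑ i, ‖(1 : ℂ) - fourier 1 (x i - x₀ i)‖ := by
      intro x
      rw [hGre, hGre]
      exact abs_sub_le_sum_of_re_trigPoly (freqBall_subset_freqCube D) Γ hGB x₀ x
    have h := integral_mul_le_of_windows (K := fun x => ψ x ^ 2) (g := G) (hψc.pow 2)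
      (fun x => sq_nonneg _) hGc x₀ (by positivity) hε hL (by rw [← hZ]; exact hwin)
    rw [← hZ] at h
    simpa [Fintype.card_fin] using h
  -- ### the oscillatory terms integrate to zero
  have hspecG : ∃ c₀ : (Fin 3 → ℤ) → ℂ, (fun x => ((G x : ℝ) : ℂ)) = trigPoly (freqCube D) c₀ := by
    have h1 : ∃ c₀ : (Fin 3 → ℤ) → ℂ, (fun x => (((trigPoly (freqBall D) Γ x).re : ℝ) : ℂ)) =
        trigPoly (freqBall D) c₀ :=
      spec_ofReal_re neg_mem_freqBall_of_mem (spec_trigPoly _ _)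
    rw [show (fun x => ((G x : ℝ) : ℂ)) = fun x => (((trigPoly (freqBall D) Γ x).re : ℝ) : ℂ) from
      funext fun x => by rw [hGre]]
    exact spec_mono h1 (freqBall_subset_freqCube D)
  obtain ⟨hosc1, hosc2⟩ := integral_envelope_sq_oscillatory_eq_zero ⟨α, hψfun⟩ hspecG hp
  -- ### integrable pieces (all continuous) and their integrals
  have hec : Continuous fun x : UnitAddTorus (Fin 3) => ((mFourier p x) ^ 2).re :=
    Complex.continuous_re.comp ((mFourier p).continuous.pow 2)
  have hw₀s : IsSmooth w₀ := by rw [hw₀]; exact isSmooth_realTrigPoly _ _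
  have hFc : Continuous fun x => inner ℝ (w₀ x) (convect w₀ W x) :=
    hw₀s.continuous.inner (hw₀s.convect hWs).continuous
  have hIw : Integrable (fun x => ‖w₀ x‖ ^ 2) volume := (hw₀s.continuous.norm.pow 2).integrable_unitAddTorus
  have hI1 : Integrable (fun x => ψ x ^ 2) volume := (hψc.pow 2).integrable_unitAddTorus
  have hI2 : Integrable (fun x => ψ x ^ 2 * G x) volume := ((hψc.pow 2).mul hGc).integrable_unitAddTorus
  have hI3 : Integrable (fun x => ψ x ^ 2 * G x * ((mFourier p x) ^ 2).re) volume :=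
    (((hψc.pow 2).mul hGc).mul hec).integrable_unitAddTorus
  have hI4 : Integrable (fun x => ψ x ^ 2 * ((mFourier p x) ^ 2).re) volume :=
    ((hψc.pow 2).mul hec).integrable_unitAddTorus
  have hI5 : Integrable (fun x => ‖U x‖ ^ 2) volume := (hUc.norm.pow 2).integrable_unitAddTorus
  have hI6 : Integrable (fun x => 4 * π * (M + 1) * ψ x ^ 2 + ‖U x‖ ^ 2 / (4 * π * (M + 1))) volume :=
    (hI1.const_mul _).add (hI5.div_const _)
  have hamgm : ∫ x, (4 * π * (M + 1) * ψ x ^ 2 + ‖U x‖ ^ 2 / (4 * π * (M + 1))) ≤ 7 * π * (M + 1) * Z := by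
    rw [integral_add (hI1.const_mul _) (hI5.div_const _), integral_const_mul, integral_div, ← hZ]
    have h1 : (∫ x, ‖U x‖ ^ 2) / (4 * π * (M + 1)) ≤ 12 * π ^ 2 * (M + 1) ^ 2 * Z / (4 * π * (M + 1)) :=
      div_le_div_of_nonneg_right hUn (by positivity)
    have h2 : 12 * π ^ 2 * (M + 1) ^ 2 * Z / (4 * π * (M + 1)) = 3 * π * (M + 1) * Z := by
      field_simp; ring
    linarith
  refine ⟨?_, ?_, ?_⟩
  · -- ### the inertial form
    have hpt : ∀ x, inner ℝ (w₀ x) (convect w₀ W x) ≤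
        2 * π ^ 2 * (ψ x ^ 2 * G x) + 2 * π ^ 2 * (ψ x ^ 2 * G x * ((mFourier p x) ^ 2).re) +
          2 * π * s * ‖P‖ * (4 * π * (M + 1) * ψ x ^ 2 + ‖U x‖ ^ 2 / (4 * π * (M + 1))) + s * ‖U x‖ ^ 2 := by
      intro x
      rw [convect, hdec x, hG x]
      exact inner_packet_pointwise_le (Torus.fderiv W x) hs0 (hA x) hn0 P (r x) (hm_sq x) (hm_abs x) (hr_le x)
    have hI123 : Integrable (fun x => 2 * π ^ 2 * (ψ x ^ 2 * G x) +
        2 * π ^ 2 * (ψ x ^ 2 * G x * ((mFourier p x) ^ 2).re) +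
        2 * π * s * ‖P‖ * (4 * π * (M + 1) * ψ x ^ 2 + ‖U x‖ ^ 2 / (4 * π * (M + 1)))) volume :=
      ((hI2.const_mul _).add (hI3.const_mul _)).add (hI6.const_mul _)
    have hI12 : Integrable (fun x => 2 * π ^ 2 * (ψ x ^ 2 * G x) +
        2 * π ^ 2 * (ψ x ^ 2 * G x * ((mFourier p x) ^ 2).re)) volume :=
      (hI2.const_mul _).add (hI3.const_mul _)
    have hIs5 : Integrable (fun x => s * ‖U x‖ ^ 2) volume := hI5.const_mul _
    have hI2' : Integrable (fun x => 2 * π ^ 2 * (ψ x ^ 2 * G x)) volume := hI2.const_mul _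
    have hI3' : Integrable (fun x => 2 * π ^ 2 * (ψ x ^ 2 * G x * ((mFourier p x) ^ 2).re)) volume :=
      hI3.const_mul _
    have hI6' : Integrable (fun x => 2 * π * s * ‖P‖ *
        (4 * π * (M + 1) * ψ x ^ 2 + ‖U x‖ ^ 2 / (4 * π * (M + 1)))) volume := hI6.const_mul _
    have hIall : Integrable (fun x => 2 * π ^ 2 * (ψ x ^ 2 * G x) +
        2 * π ^ 2 * (ψ x ^ 2 * G x * ((mFourier p x) ^ 2).re) +
        2 * π * s * ‖P‖ * (4 * π * (M + 1) * ψ x ^ 2 + ‖U x‖ ^ 2 / (4 * π * (M + 1))) + s * ‖U x‖ ^ 2)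
        volume := hI123.add hIs5
    have hint := integral_mono hFc.integrable_unitAddTorus hIall hpt
    have hsplit : ∫ x, (2 * π ^ 2 * (ψ x ^ 2 * G x) +
        2 * π ^ 2 * (ψ x ^ 2 * G x * ((mFourier p x) ^ 2).re) +
        2 * π * s * ‖P‖ * (4 * π * (M + 1) * ψ x ^ 2 + ‖U x‖ ^ 2 / (4 * π * (M + 1))) + s * ‖U x‖ ^ 2) =
        2 * π ^ 2 * (∫ x, ψ x ^ 2 * G x) + 2 * π ^ 2 * (∫ x, ψ x ^ 2 * G x * ((mFourier p x) ^ 2).re) +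
        2 * π * s * ‖P‖ * (∫ x, (4 * π * (M + 1) * ψ x ^ 2 + ‖U x‖ ^ 2 / (4 * π * (M + 1)))) +
        s * ∫ x, ‖U x‖ ^ 2 := by
      rw [integral_add hI123 hIs5, integral_add hI12 hI6', integral_add hI2' hI3', integral_const_mul,
        integral_const_mul, integral_const_mul, integral_const_mul]
    rw [hsplit, hosc1, mul_zero, add_zero] at hint
    have hx1 := mul_le_mul_of_nonneg_left hamgm (by positivity : (0 : ℝ) ≤ 2 * π * s * ‖P‖)
    have hx2 := mul_le_mul_of_nonneg_left hUn hs0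
    have hx3 := mul_le_mul_of_nonneg_left hker (by positivity : (0 : ℝ) ≤ 2 * π ^ 2)
    linarith [hint, hx1, hx2, hx3]
  · -- ### the energy, lower bound
    have hpt : ∀ x, 2 * π ^ 2 * ‖P‖ ^ 2 * ψ x ^ 2 + 2 * π ^ 2 * ‖P‖ ^ 2 * (ψ x ^ 2 * ((mFourier p x) ^ 2).re) -
        2 * π * ‖P‖ * (4 * π * (M + 1) * ψ x ^ 2 + ‖U x‖ ^ 2 / (4 * π * (M + 1))) ≤ ‖w₀ x‖ ^ 2 := by
      intro x
      rw [hdec x]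
      exact (norm_packet_pointwise_bounds hn0 P (r x) (hm_sq x) (hm_abs x) (hr_le x)).1
    have hIa : Integrable (fun x => 2 * π ^ 2 * ‖P‖ ^ 2 * ψ x ^ 2 +
        2 * π ^ 2 * ‖P‖ ^ 2 * (ψ x ^ 2 * ((mFourier p x) ^ 2).re)) volume :=
      (hI1.const_mul _).add (hI4.const_mul _)
    have hIb : Integrable (fun x => 2 * π * ‖P‖ *
        (4 * π * (M + 1) * ψ x ^ 2 + ‖U x‖ ^ 2 / (4 * π * (M + 1)))) volume := hI6.const_mul _
    have hI1' : Integrable (fun x => 2 * π ^ 2 * ‖P‖ ^ 2 * ψ x ^ 2) volume := hI1.const_mul _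
    have hI4' : Integrable (fun x => 2 * π ^ 2 * ‖P‖ ^ 2 * (ψ x ^ 2 * ((mFourier p x) ^ 2).re)) volume :=
      hI4.const_mul _
    have hIab : Integrable (fun x => 2 * π ^ 2 * ‖P‖ ^ 2 * ψ x ^ 2 +
        2 * π ^ 2 * ‖P‖ ^ 2 * (ψ x ^ 2 * ((mFourier p x) ^ 2).re) -
        2 * π * ‖P‖ * (4 * π * (M + 1) * ψ x ^ 2 + ‖U x‖ ^ 2 / (4 * π * (M + 1)))) volume := hIa.sub hIb
    have hint := integral_mono hIab hIw hpt
    have hsplit : ∫ x, (2 * π ^ 2 * ‖P‖ ^ 2 * ψ x ^ 2 +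
        2 * π ^ 2 * ‖P‖ ^ 2 * (ψ x ^ 2 * ((mFourier p x) ^ 2).re) -
        2 * π * ‖P‖ * (4 * π * (M + 1) * ψ x ^ 2 + ‖U x‖ ^ 2 / (4 * π * (M + 1)))) =
        2 * π ^ 2 * ‖P‖ ^ 2 * (∫ x, ψ x ^ 2) +
        2 * π ^ 2 * ‖P‖ ^ 2 * (∫ x, ψ x ^ 2 * ((mFourier p x) ^ 2).re) -
        2 * π * ‖P‖ * ∫ x, (4 * π * (M + 1) * ψ x ^ 2 + ‖U x‖ ^ 2 / (4 * π * (M + 1))) := by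
      rw [integral_sub hIa hIb, integral_add hI1' hI4', integral_const_mul, integral_const_mul,
        integral_const_mul]
    rw [hsplit, hosc2, mul_zero, add_zero, ← hZ] at hint
    have hx1 := mul_le_mul_of_nonneg_left hamgm (by positivity : (0 : ℝ) ≤ 2 * π * ‖P‖)
    linarith [hint, hx1]
  · -- ### the energy, upper bound
    have hpt : ∀ x, ‖w₀ x‖ ^ 2 ≤
        2 * π ^ 2 * ‖P‖ ^ 2 * ψ x ^ 2 + 2 * π ^ 2 * ‖P‖ ^ 2 * (ψ x ^ 2 * ((mFourier p x) ^ 2).re) +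
        2 * π * ‖P‖ * (4 * π * (M + 1) * ψ x ^ 2 + ‖U x‖ ^ 2 / (4 * π * (M + 1))) + ‖U x‖ ^ 2 := by
      intro x
      rw [hdec x]
      exact (norm_packet_pointwise_bounds hn0 P (r x) (hm_sq x) (hm_abs x) (hr_le x)).2
    have hIa : Integrable (fun x => 2 * π ^ 2 * ‖P‖ ^ 2 * ψ x ^ 2 +
        2 * π ^ 2 * ‖P‖ ^ 2 * (ψ x ^ 2 * ((mFourier p x) ^ 2).re)) volume :=
      (hI1.const_mul _).add (hI4.const_mul _)
    have hIb : Integrable (fun x => 2 * π * ‖P‖ *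
        (4 * π * (M + 1) * ψ x ^ 2 + ‖U x‖ ^ 2 / (4 * π * (M + 1)))) volume := hI6.const_mul _
    have hIab : Integrable (fun x => 2 * π ^ 2 * ‖P‖ ^ 2 * ψ x ^ 2 +
        2 * π ^ 2 * ‖P‖ ^ 2 * (ψ x ^ 2 * ((mFourier p x) ^ 2).re) +
        2 * π * ‖P‖ * (4 * π * (M + 1) * ψ x ^ 2 + ‖U x‖ ^ 2 / (4 * π * (M + 1)))) volume := hIa.add hIb
    have hI1' : Integrable (fun x => 2 * π ^ 2 * ‖P‖ ^ 2 * ψ x ^ 2) volume := hI1.const_mul _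
    have hI4' : Integrable (fun x => 2 * π ^ 2 * ‖P‖ ^ 2 * (ψ x ^ 2 * ((mFourier p x) ^ 2).re)) volume :=
      hI4.const_mul _
    have hIall : Integrable (fun x => 2 * π ^ 2 * ‖P‖ ^ 2 * ψ x ^ 2 +
        2 * π ^ 2 * ‖P‖ ^ 2 * (ψ x ^ 2 * ((mFourier p x) ^ 2).re) +
        2 * π * ‖P‖ * (4 * π * (M + 1) * ψ x ^ 2 + ‖U x‖ ^ 2 / (4 * π * (M + 1))) + ‖U x‖ ^ 2) volume :=
      hIab.add hI5
    have hint := integral_mono hIw hIall hpt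
    have hsplit : ∫ x, (2 * π ^ 2 * ‖P‖ ^ 2 * ψ x ^ 2 +
        2 * π ^ 2 * ‖P‖ ^ 2 * (ψ x ^ 2 * ((mFourier p x) ^ 2).re) +
        2 * π * ‖P‖ * (4 * π * (M + 1) * ψ x ^ 2 + ‖U x‖ ^ 2 / (4 * π * (M + 1))) + ‖U x‖ ^ 2) =
        2 * π ^ 2 * ‖P‖ ^ 2 * (∫ x, ψ x ^ 2) +
        2 * π ^ 2 * ‖P‖ ^ 2 * (∫ x, ψ x ^ 2 * ((mFourier p x) ^ 2).re) +
        2 * π * ‖P‖ * (∫ x, (4 * π * (M + 1) * ψ x ^ 2 + ‖U x‖ ^ 2 / (4 * π * (M + 1)))) +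
        ∫ x, ‖U x‖ ^ 2 := by
      rw [integral_add hIab hI5, integral_add hIa hIb, integral_add hI1' hI4', integral_const_mul,
        integral_const_mul, integral_const_mul]
    rw [hsplit, hosc2, mul_zero, add_zero, ← hZ] at hint
    have hx1 := mul_le_mul_of_nonneg_left hamgm (by positivity : (0 : ℝ) ≤ 2 * π * ‖P‖)
    linarith [hint, hx1, hUn]

end Summit.AnomalousDissipation.AnomalousDissipation.Theorems
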